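import Summits.QuantumFields.YangMills.Theorems.BalabanUVNodesPortHRecordJoin
import Summits.QuantumFields.YangMills.Theorems.BalabanUVNodesPortHRecordJoinWithDefs

/-!
# PORT helper (PT-H ∕ K0ᴬ JOIN lineage) — THE CONSUMER CERTIFICATE FOR EVERY TOKEN:
# `joinGoalWith_of_texts (Tok) (hBr : ∀ F Mc a₀, Tok F Mc a₀ → TokP9L4Old F Mc a₀) (F) : Sig8LR4 F → Sig7With Tok F → JoinGoalWith Tok F`
# (lens-1 JOIN v5.5 §20 (F3), director-ym №495 (i)), its receipts, and the v9-L instance `Tok := TokP9L4New` recovered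

AUTHORSHIP ∕ CREDIT.  The mathematics and the Lean text below are ◇ LENS-1's (planner seat `ymgap-nodeO-lens-1` g5), HOME file
`pub/ym-nodeO-ideate/nodeO-cover/LENS-1-Slot8RecordJoin-v5.5.lean` (sha16 a8fd07347335edf6) §20 «THE CONSUMER FREEZE, KERNEL-CERTIFIED FOR EVERY TOKEN» (★★★ director-ym №495
order (i): «lens-1 FREEZES the consumer goal FIRST»; frozen bodies `nodeO-cover/LENS-1-FREEZE-Sig7With-body.txt` ∕ `…-JoinGoalWith-body.txt` ∕ `…-C1.txt`) and v5.2 §16's token blocks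
(= ◆ TYPER-1 g3's probe bytes f468831c), landed for the tree by porter PTC-1 g3 (`ymgap-nodeO-port-PTC-1`) keyed `--supports stmt-QuantumFields-27238 --as helper` (K0ᴬ; no `--workitem`,
R615).  Deviations from the HOME bytes: namespace `…Theorems.PortHRecordJoin`; the family binder `F` explicit on `Sig7With ∕ JoinGoalWith` (as on the tree's `Sig8LR4 ∕ Sig7L9 ∕ JoinGoalL`);
receipts RowG ∕ (E1′) ∕ (E4a) ∕ bridge cited BY NAME from the tree; NO import of the route file (port-lead docket O-8: re-key-robust keying).  [I] = [Balaban1987RG1], [15] = [Balaban1985Variational].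

THIS FILE (JOIN v5.5 §20 (F3)(F4)(F3′) in the PER-FAMILY arity of lens-1's tree twin `nodeO-cover/LENS-1-RecordJoinG4-tree-v1.lean` dff20cec68fe4510 :49–:127, re-keyed to the tree's receipts):
* `consumerC1_iff` — the frozen (C1) IS `∀ a, Response9DAtL …` at the fill (`Iff.rfl`); `joinGoalL_eq_joinGoalWith` — `JoinGoalL F = JoinGoalWith TokP9L4New F` (`rfl`);
  `sig7With_of_sig7L9` — the v9-L text projects onto the interface at `Tok := TokP9L4New` (drop (C2a)(C2b)).
* `tokP9L4Old_of_new` — ★ PTB-1's bridge ✓p802240 at the names; ★★★★★★★★ `joinGoalWith_of_texts (Tok) (hBr) (F) (h8 : Sig8LR4 F) (h7 : Sig7With Tok F) : JoinGoalWith Tok F` — ⁸ at `F`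
  (27930 SIGNED 12934e3f, OPEN) ∧ ANY ⁷-shaped text at `F` whose token implies ⁸'s 13th hypothesis `TokP9L4Old` ⟹ `JoinGoalWith Tok F` (+ primed `∀ F` form).  The token is threaded OPAQUELY; the run-level consumer is the tree's ★★★★★★ `recordPlimDecayOnRunsAx_at_recordEmbL_of_trace` (`…PortHRecordJoin` :154);
  receipts RowG ✓p801674 `PortHRecordRowG.rowG_slot8_at_names`, (E4a) ✓p801893 via `responseRowAtL_of_p9RegAt`, (E1′) ✓p805389 via `iotaRowAtL_of_p9RegAt` — all BY NAME.  So a cut ⁷-b of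
  stmt-QuantumFields-27931 passes the consumer test J3′ iff (a) its consequent ⊇ (C1) (projection onto `Sig7With Tok`) and (b) its token implies `TokP9L4Old`.
* `joinGoalL_of_texts_param` — the tree's v9-L JOIN `joinGoalL_of_texts_final` recovered as the instance `Tok := TokP9L4New` (bridge ★ PTB-1 ✓p802240 `PortU8.tokP9L4_old_of_new`);
  `joinGoalWith_of_texts_conj (Loc)` — (F3′) the two-token instance `Tok := TokP9L4New ∧ Loc` (bridge on the first conjunct; `Loc` a free parameter, nothing about it assumed).

HONEST FRAMING.  An implication SCHEMA between hypothesis-shaped texts, token-parametric: the token's print fidelity and the final cut of stmt-QuantumFields-27931 are ◆ CRIT-1's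
calls (J1–J5, J1′, J3′); nothing of [I] (Thm 1, (1.19)–(1.22), (4.33)–(4.37), (5.10)) or [15] (Thm 1, Prop. 9, (190)) is asserted, ported, discharged or refuted; TokP9-reg NOT proved;
27930 ⁸ ∕ 27931 ⁷ ∕ 26648 OPEN; K-Ax 27238∕27239∕27247 OPEN; K0⁷∕K0ᴬ OPEN; NODE O 0∕1; COUNT 8∕28 · K 1∕4 UNMOVED; ONE finite `𝕋⁴_{L^K}` at fixed ε — NOT continuum ∕ OS ∕ Clay;
**the Yang–Mills mass gap (Clay) is NOT proved by any of this.**  No `sorry`, no `instance`, no `notation`; standard axioms.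
-/

noncomputable section

open scoped BigOperators Matrix.Norms.L2Operator Topology
open Set Filter

namespace Summit.QuantumFields.YangMills.Theorems.PortHRecordJoin

open Summit.QuantumFields.YangMills.Theorems.K0RecordFormatNames
open Summit.QuantumFields.YangMills.Theorems
open Literature.MathematicalPhysics.QuantumFieldTheory.Balaban1983to89
open Literature.MathematicalPhysics.QuantumFieldTheory.Balaban1983to89.Node00
open Literature.MathematicalPhysics.QuantumFieldTheory.Balaban1983to89.T4Continuum (T4Family)
open NormedSpace (exp)

/-- RECEIPT (F2′): the frozen (C1) IS `∀ a, Response9DAtL …` at the fill (kernel `Iff.rfl`). [cite: Balaban1985Variational, Prop. 9 p.309, (21) p.281] -/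
theorem consumerC1_iff (F : T4Family) (Mc : ℕ) (a₀ α₂ C₉ δ₀ : ℝ) (k : ℕ) (ε₂₉ : ℝ) :
    ConsumerC1 F Mc a₀ α₂ C₉ δ₀ k ε₂₉ ↔
      letI θ := thetaFill F a₀ ε₂₉; letI := θ.instιβ
      ∀ a : θ.ιβ, Response9DAtL F θ a Mc k (recordK₀ F Mc k) α₂ C₉ δ₀ := Iff.rfl

/-- RECEIPT (F1): the tree's v9-L goal IS the instance `Tok := TokP9L4New` (kernel `rfl`). [cite: Balaban1987RG1, (4.35) p.290] -/
theorem joinGoalL_eq_joinGoalWith (F : T4Family) : JoinGoalL F = JoinGoalWith TokP9L4New F := rfl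

/-- The tree bridge ★ PTB-1 ✓p802240 `PortU8.tokP9L4_old_of_new` AT THE NAMES: TokP9L4‴ ⟹ ⁸'s 13th hypothesis. [cite: Balaban1985Variational, Prop. 9 p.309, (190) p.308, (21) p.281] -/
theorem tokP9L4Old_of_new (F : T4Family) (Mc : ℕ) (a₀ : ℝ) (h : TokP9L4New F Mc a₀) : TokP9L4Old F Mc a₀ :=
  PortU8.tokP9L4_old_of_new F Mc a₀ h

/-- RECEIPT (F4): the signed v9-L text projects onto the interface at `Tok := TokP9L4New` (drop (C2a)(C2b)), per family. [cite: Balaban1985Variational, Prop. 9 p.309; Balaban1987RG1, (4.35) p.290] -/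
theorem sig7With_of_sig7L9 (F : T4Family) (h7 : Sig7L9 F) : Sig7With TokP9L4New F := by
  intro Mc j c c₀ c₁ B₃ B₃' a₀ a₁ hG0 hc hc₀ hc₁ hB₃ hB₃' ha₀ ha₁ hThm hGauge hUk hBg hP9 α₂ hα₂
  obtain ⟨C₉, δ₀, hC₉, hδ₀, h7k⟩ := h7 Mc j c c₀ c₁ B₃ B₃' a₀ a₁ hG0 hc hc₀ hc₁ hB₃ hB₃' ha₀ ha₁ hThm hGauge hUk hBg hP9 α₂ hα₂
  exact ⟨C₉, δ₀, hC₉, hδ₀, fun k ε₂₉ hε => (h7k k ε₂₉ hε).1⟩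

/-- ★★★★★★★★ **(F3) THE CONSUMER CERTIFICATE — FOR EVERY TOKEN, PER FAMILY** (lens-1 JOIN v5.5 §20 ∕ tree twin dff20cec, director-ym №495 (i); re-keyed to the tree's receipts).
⁸ at `F` (`Sig8LR4 F`, 27930 SIGNED 12934e3f, OPEN) ∧ any ⁷-shaped text at `F` (`Sig7With Tok F`) whose token implies ⁸'s 13th hypothesis `TokP9L4Old` ⟹ `JoinGoalWith Tok F`.  LETTERS:
`γ₀ ε₂₉ E₀ κ α₀ α₁` := ⁸'s witnesses (⁸ fed ONCE through `hBr`); `α₂ := min ¼ (min α₁ (α₀∕36))`; `C₉ δ₀` := ⁷'s witnesses at that `α₂`; `Mg := 4·Mc + 1`, `c₁ := 2`, `K₁ := (2·(1 − e^{−δ₀∕2})⁻¹)⁴`,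
`K₀ := B12TreeDecay.K₀ (4·2⁴) (2·4)`; `C := 16·E₀·C₉²·e^{δ₁ Mg c₁}·K₀·K₁`, `δ₁ := delta1 δ₀ κ Mg`.  The token is threaded OPAQUELY — the proof never looks inside it: the consumer's needs from ⁷
are EXACTLY (C1) and `Tok ⟹ TokP9L4Old`.  Receipts BY NAME: run level ★★★★★★ `recordPlimDecayOnRunsAx_at_recordEmbL_of_trace` (✓p807054), RowG ✓p801674, (E1′) ✓p805389, (E4a) ✓p801893.
HONEST: an implication schema between hypothesis-shaped texts; nothing of [I]∕[15] discharged; 27930∕27931 OPEN; K0⁷∕K0ᴬ OPEN; NODE O 0∕1; **the Yang–Mills mass gap is NOT proved.**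
[cite: Balaban1987RG1, Thm 1 p.259, (0.20) p.256, (1.19)–(1.22) pp.263–264, (4.35)–(4.37) p.290, (5.10) p.293; Balaban1985Variational, Prop. 9 p.309, (190) p.308, (21) p.281] -/
theorem joinGoalWith_of_texts (Tok : T4Family → ℕ → ℝ → Prop)
    (hBr : ∀ (F : T4Family) (Mc : ℕ) (a₀ : ℝ), Tok F Mc a₀ → TokP9L4Old F Mc a₀)
    (F : T4Family) (h8 : Sig8LR4 F) (h7 : Sig7With Tok F) : JoinGoalWith Tok F := by
  unfold Sig8LR4 at h8
  obtain ⟨Mth, h8F⟩ := h8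
  unfold JoinGoalWith
  refine ⟨Mth, ?_⟩
  intro Mc hMc j c c₀ c₁ B₃ B₃' a₀ a₁ hG0 hc hc₀ hc₁ hB₃ hB₃' ha₀ ha₁ hThm hGauge hUk hBg hP9
  have hP9old : TokP9L4Old F Mc a₀ := hBr F Mc a₀ hP9
  obtain ⟨γ₀, ε₂₉, E₀, κ, α₀, α₁, hγ₀, hε, hE₀, hκ4, hα₀, hα₁, hFmt⟩ :=
    h8F Mc hMc j c c₀ c₁ B₃ B₃' a₀ a₁ hG0 hc hc₀ hc₁ hB₃ hB₃' ha₀ ha₁ hThm hGauge hUk hBg hP9old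
  have hα₂ : 0 < min (1 / 4 : ℝ) (min α₁ (α₀ / 36)) := lt_min (by norm_num) (lt_min hα₁ (by positivity))
  obtain ⟨C₉, δ₀, hC₉, hδ₀, h7k⟩ :=
    h7 Mc j c c₀ c₁ B₃ B₃' a₀ a₁ hG0 hc hc₀ hc₁ hB₃ hB₃' ha₀ ha₁ hThm hGauge hUk hBg hP9 _ hα₂
  have hκ : 0 < κ := by linarith [kappa₀_std_pos]
  have hκ2 : 2 * B12TreeDecay.kappa₀ (4 * 2 ^ 4) (2 * 4) ≤ κ := by linarith [kappa₀_std_pos]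
  have hMg : 0 < 4 * (Mc : ℝ) + 1 := by positivity
  have hMg4 : 4 * (Mc : ℝ) ≤ 4 * (Mc : ℝ) + 1 := by linarith
  refine ⟨γ₀, ε₂₉, 16 * E₀ * C₉ ^ 2 * Real.exp (B12Decay510.delta1 δ₀ κ (4 * (Mc : ℝ) + 1) * (4 * (Mc : ℝ) + 1) * 2) *
      B12TreeDecay.K₀ (4 * 2 ^ 4) (2 * 4) * (2 * (1 - Real.exp (-(δ₀ / 2)))⁻¹) ^ 4,
    B12Decay510.delta1 δ₀ κ (4 * (Mc : ℝ) + 1), hγ₀, hε, fun h121 => ?_⟩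
  exact recordPlimDecayOnRunsAx_at_recordEmbL_of_trace (E₀ := E₀) (κ := κ) (C₉ := C₉) (δ₀ := δ₀) (Mg := 4 * (Mc : ℝ) + 1) (c₁ := 2)
    (K₀' := B12TreeDecay.K₀ (4 * 2 ^ 4) (2 * 4)) (K₁ := (2 * (1 - Real.exp (-(δ₀ / 2)))⁻¹) ^ 4) hE₀ hκ hC₉ hδ₀ hMg (B12TreeDecay.K₀_pos _ _).le
    F a₀ ε₂₉ γ₀ α₀ α₁ hα₀ hα₁ Mc hFmt (fun k n => hBg k n ε₂₉ hε)
    (fun k => ⟨h7k k ε₂₉ hε,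
      fun n => iotaRowAtL_of_p9RegAt F a₀ ε₂₉ ha₀ k _ (BalabanUVNodesPortS1.succ_le_m_add_K_recordK₀ F Mc k n) (hBg k n ε₂₉ hε),
      fun n a => responseRowAtL_of_p9RegAt F a₀ ε₂₉ ha₀ k _ (BalabanUVNodesPortS1.succ_le_m_add_K_recordK₀ F Mc k n) (hBg k n ε₂₉ hε) a⟩)
    (fun k => PortHRecordRowG.rowG_slot8_at_names (F := F) (k := k) hG0 hMg4 hκ2 hδ₀) h121

/-- The same with both texts universally quantified (`∀ F`). [cite: Balaban1987RG1, Thm 1 p.259, (4.35) p.290] -/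
theorem joinGoalWith_of_texts' (Tok : T4Family → ℕ → ℝ → Prop)
    (hBr : ∀ (F : T4Family) (Mc : ℕ) (a₀ : ℝ), Tok F Mc a₀ → TokP9L4Old F Mc a₀)
    (h8 : ∀ F, Sig8LR4 F) (h7 : ∀ F, Sig7With Tok F) : ∀ F : T4Family, JoinGoalWith Tok F :=
  fun F => joinGoalWith_of_texts Tok hBr F (h8 F) (h7 F)

/-- **(F3′) THE TWO-TOKEN INSTANCE, per family**: if the last signing's token is a CONJUNCTION `TokP9L4‴ ∧ Loc`, the bridge obligation is discharged by the tree bridge on the first conjunct —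
so J3′ reduces to the single projection «consequent ⊇ (C1)».  `Loc` is a free parameter; nothing about its content is assumed or asserted.
[cite: Balaban1985Variational, Prop. 9 p.309, (190) p.308; Balaban1987RG1, (3.37) p.277, (4.35) p.290] -/
theorem joinGoalWith_of_texts_conj (Loc : T4Family → ℕ → ℝ → Prop) (F : T4Family)
    (h8 : Sig8LR4 F) (h7 : Sig7With (fun F Mc a₀ => TokP9L4New F Mc a₀ ∧ Loc F Mc a₀) F) :
    JoinGoalWith (fun F Mc a₀ => TokP9L4New F Mc a₀ ∧ Loc F Mc a₀) F :=
  joinGoalWith_of_texts _ (fun F Mc a₀ h => tokP9L4Old_of_new F Mc a₀ h.1) F h8 h7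

/-- RECEIPT (F4): the tree's v9-L JOIN recovered as the instance `Tok := TokP9L4New` of the certificate, per family (so `joinGoalL_of_texts_final` = `fun h8 h7 F => … F (h8 F) (h7 F)`).
[cite: Balaban1987RG1, (4.35) p.290; Balaban1985Variational, Prop. 9 p.309, (190) p.308] -/
theorem joinGoalL_of_texts_param (F : T4Family) (h8 : Sig8LR4 F) (h7 : Sig7L9 F) : JoinGoalL F :=
  joinGoalWith_of_texts TokP9L4New tokP9L4Old_of_new F h8 (sig7With_of_sig7L9 F h7)

end Summit.QuantumFields.YangMills.Theorems.PortHRecordJoin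

end
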